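import Summits.AtomisticToContinuum.Crystallization.Theorems.ExcessDecayLiouvilleHcpLiouvilleOfInputs

/-!
# `ExcessDecayLiouville.HcpLiouville` (stmt-AtomisticToContinuum-9332), line `Sketch` v5: the anchored blow-down

Stub `stub_anchoredBlowdown` (composition B of skeleton v5 of the line `Sketch`, crux `HcpLiouville`):
harmonic stability `PhononStability` and ray-secant coercivity `SecantCoercive 0 κ₁` at anchor radius `0`
give the coarse Liouville theorem for EQUILIBRIUM data — an admissible hcp-like datum `(t, A)` (`Adm₀ A`,
`Inner₀ t A`) whose own site set is in force balance (`Equil₀ (Sites₀ t A)`): every uniformly separated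
equilibrium configuration `X` globally two-way `1/40`-matched with `Sites₀ t A` is a translate of it.

Proof.  This is the landed v4 composition `BlowdownLine.core_of_inputs` read at anchor shift `τ = 0`
(`anchorDatum t 0 = t`), where no relaxed-shift input is needed because the datum itself is an equilibrium
two-lattice: `κ` from `phononStability_iff`, the displacement `u` from `stub_onePerSite`, the Caccioppoli
constant from `stub_caccioppoli 0 κ₁`, then `stub_remainder`, `stub_green κ`, `stub_interior κ`,
`stub_improvement 0 κ …` fed with `‖(0 : E3)‖ ≤ 0`, the harmonic-stability inequality
`Blowdown.psIneq_of_forall`, the Campanato iteration `stub_iteration` (constancy of the displacement seen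
from the anchored sites) and the bookkeeping `BlowdownLine.sites_of_constant`.
All `[folklore]`; a `--supports` helper for item stmt-AtomisticToContinuum-9332, nothing here closes an item.
-/

noncomputable section

namespace Summit.AtomisticToContinuum.Crystallization.Theorems.ExcessDecayLiouville

open scoped BigOperators Topology Classical InnerProductSpace
open Literature.MathematicalPhysics.StatisticalMechanics
open Summit.AtomisticToContinuum.Crystallization.Theses.ExcessDecayLiouville
open Summit.AtomisticToContinuum.Crystallization.Theorems.PhononStabilityNegative

local notation "E3" => EuclideanSpace ℝ (Fin 3)

/-- **The anchored blow-down** (composition B of the line `Sketch`, skeleton v5): harmonic stability and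
ray-secant coercivity `SecantCoercive 0 κ₁` at anchor radius `0` give the coarse Liouville theorem for
EQUILIBRIUM data `(t, A)` (`Equil₀ (Sites₀ t A)`) — the v4 blow-down `BlowdownLine.core_of_inputs` at anchor
shift `τ = 0`. [folklore] -/
theorem stub_anchoredBlowdown :
    PhononStability → ∀ κ₁ : ℝ, 0 < κ₁ → SecantCoercive 0 κ₁ →
      ∀ δ : ℝ, 0 < δ → ∀ X : Set E3, Sep₀ X δ → Equil₀ X →
        ∀ (t : Fin 2 → E3) (A : E3 →L[ℝ] E3), Adm₀ A → Inner₀ t A → Equil₀ (Sites₀ t A) →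
          (∀ (c : E3) (r : ℝ), Near₀ X c r t A (1 / 40)) →
            ∃ (t' : Fin 2 → E3) (A' : E3 →L[ℝ] E3), Adm₀ A' ∧ X = Sites₀ t' A' := by
  intro hPS κ₁ hκ₁ hSC δ hδ X hSep hEq t A hA hI hEt hN
  obtain ⟨κ, hκ, hPSκ⟩ := phononStability_iff.1 hPS
  obtain ⟨u, hu⟩ := stub_onePerSite δ hδ X hSep hEq t A hA hI hN
  -- the anchor shift is `τ = 0`: the anchored datum is the datum itself
  have hI0 : Inner₀ (anchorDatum t 0) A := by rw [anchorDatum_zero_shift]; exact hI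
  have hE0 : Equil₀ (Sites₀ (anchorDatum t 0) A) := by rw [anchorDatum_zero_shift]; exact hEt
  have hτ : ‖(0 : E3)‖ ≤ 0 := by rw [norm_zero]
  obtain ⟨C_C, hC⟩ := stub_caccioppoli 0 κ₁ hκ₁ hSC
  obtain ⟨C_R, hR⟩ := stub_remainder
  obtain ⟨C_F, hF⟩ := stub_green κ hκ
  obtain ⟨C_D, hD⟩ := stub_interior κ hκ
  obtain ⟨θ, R₀, K, hθ, hθ1, hR₀, hImp⟩ := stub_improvement 0 κ C_C C_R C_F C_D hκ hC hR hF hD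
  have hPSτ : Blowdown.PSIneq κ (anchorDatum t 0) A := Blowdown.psIneq_of_forall hPSκ hA hI0
  have hIP := hImp X t A u 0 hA hI hPSτ hEq hu hτ hI0 hE0
  obtain ⟨m, hm⟩ := stub_iteration (Sites₀ (anchorDatum t 0) A) (LevelOne.vField t A 0 u) θ R₀ K
    (fun c r => finite_sites_dist_le hA hI0 c r) (fun c r hr F hF => BlowdownLine.card_ball_le hA hI0 c hr F hF)
    (fun c => BlowdownLine.exists_site_near hA (anchorDatum t 0) c)
    (fun s hs => LevelOne.norm_vField_le hA hI hI0 hu hs) hθ hθ1 hR₀ hIP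
  exact ⟨fun i => anchorDatum t 0 i + m, A, hA, BlowdownLine.sites_of_constant hA hI hI0 hu hm⟩

end Summit.AtomisticToContinuum.Crystallization.Theorems.ExcessDecayLiouville

end
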